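import Summits.SmoothPoincare4.SmoothPoincare4.Theses.EuclideanOrigami

/-!
# Birth skeleton — piece `TripleCircleElimination` of the crease ladder (crux `CreaseCollapse`,
stmt-SmoothPoincare4-7481, route EuclideanOrigami)

Line `ladder_triple`: ISOLATE one connected component `c` of the triple-value set `T` of a quadruple-free
crease with finitely many triple-value components (finitely many components ⇒ each is relatively open:
`stub_isolateComponent`, point-set topology, provable now), then ELIMINATE that component CONSERVATIVELY
(`stub_conservativeElimination`, the geometric crux: a Carter-type elimination of one triple circle of a
codimension-one immersion `S³ ↬ ℝ⁴`, performed THROUGH immersed fake balls — no new triple value, no triple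
value left in the isolating neighbourhood, old components met are kept whole). The composition
`TripleCircleElimination_of` is the component bookkeeping (`components_subset_of_saturated`): the new
component set lies in the old one minus `c`, hence is finite and strictly smaller.
-/

set_option linter.dupNamespace false

namespace Summit.SmoothPoincare4.SmoothPoincare4.Cruxes.CreaseCollapse.LadderTriple

open scoped Manifold ContDiff Topology
open Set Function

/-- Local copy of the piece (verbatim the route child `TripleCircleElimination`). -/
def TripleCircleElimination : Prop :=
  ∀ (S : Literature.Topology.FourManifolds.HomotopySphere 4) (e : EuclideanSpace ℝ (Fin 4) → S.carrier) (F : S.carrier → EuclideanSpace ℝ (Fin 4)), Manifold.IsSmoothEmbedding (𝓡 4) (𝓡 4) ∞ e → (∀ x, x ∉ e '' Metric.ball (0 : EuclideanSpace ℝ (Fin 4)) 1 → IsLocalDiffeomorphAt (𝓡 4) (𝓡 4) ∞ F x) → {y : EuclideanSpace ℝ (Fin 4) | ∃ a b c d : EuclideanSpace ℝ (Fin 4), ‖a‖ = 1 ∧ ‖b‖ = 1 ∧ ‖c‖ = 1 ∧ ‖d‖ = 1 ∧ a ≠ b ∧ a ≠ c ∧ a ≠ d ∧ b ≠ c ∧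 b ≠ d ∧ c ≠ d ∧ F (e a) = y ∧ F (e b) = y ∧ F (e c) = y ∧ F (e d) = y} = ∅ → ((fun y => connectedComponentIn {y : EuclideanSpace ℝ (Fin 4) | ∃ u v w : EuclideanSpace ℝ (Fin 4), ‖u‖ = 1 ∧ ‖v‖ = 1 ∧ ‖w‖ = 1 ∧ u ≠ v ∧ v ≠ w ∧ u ≠ w ∧ F (e u) = y ∧ F (e v) = y ∧ F (e w) = y} y) '' {y : EuclideanSpace ℝ (Fin 4) | ∃ u v w : EuclideanSpace ℝ (Fin 4), ‖u‖ = 1 ∧ ‖v‖ = 1 ∧ ‖w‖ = 1 ∧ u ≠ v ∧ v ≠ w ∧ u ≠ w ∧ F (e u) = y ∧ F (e v) = y ∧ F (e w) = y}).Finite → {y : EuclideanSpace ℝ (Fin 4) | ∃ u v w : EuclideanSpace ℝ (Fin 4), ‖u‖ = 1 ∧ ‖v‖ = 1 ∧ ‖w‖ = 1 ∧ u ≠ v ∧ v ≠ w ∧ u ≠ w ∧ F (e u) = y ∧ F (e v) = y ∧ F (e w) = y}.Nonempty → ∃ F' : S.carrier → EuclideanSpace ℝ (Fin 4), (∀ x,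 x ∉ e '' Metric.ball (0 : EuclideanSpace ℝ (Fin 4)) 1 → IsLocalDiffeomorphAt (𝓡 4) (𝓡 4) ∞ F' x) ∧ {y : EuclideanSpace ℝ (Fin 4) | ∃ a b c d : EuclideanSpace ℝ (Fin 4), ‖a‖ = 1 ∧ ‖b‖ = 1 ∧ ‖c‖ = 1 ∧ ‖d‖ = 1 ∧ a ≠ b ∧ a ≠ c ∧ a ≠ d ∧ b ≠ c ∧ b ≠ d ∧ c ≠ d ∧ F' (e a) = y ∧ F' (e b) = y ∧ F' (e c) = y ∧ F' (e d) = y} = ∅ ∧ ((fun y => connectedComponentIn {y : EuclideanSpace ℝ (Fin 4) | ∃ u v w : EuclideanSpace ℝ (Fin 4), ‖u‖ = 1 ∧ ‖v‖ = 1 ∧ ‖w‖ = 1 ∧ u ≠ v ∧ v ≠ w ∧ u ≠ w ∧ F' (e u) = y ∧ F' (e v) = y ∧ F' (e w) = y} y) '' {y : EuclideanSpace ℝ (Fin 4) | ∃ u v w : EuclideanSpace ℝ (Fin 4), ‖u‖ = 1 ∧ ‖v‖ = 1 ∧ ‖w‖ = 1 ∧ u ≠ v ∧ v ≠ w ∧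 u ≠ w ∧ F' (e u) = y ∧ F' (e v) = y ∧ F' (e w) = y}).Finite ∧ ((fun y => connectedComponentIn {y : EuclideanSpace ℝ (Fin 4) | ∃ u v w : EuclideanSpace ℝ (Fin 4), ‖u‖ = 1 ∧ ‖v‖ = 1 ∧ ‖w‖ = 1 ∧ u ≠ v ∧ v ≠ w ∧ u ≠ w ∧ F' (e u) = y ∧ F' (e v) = y ∧ F' (e w) = y} y) '' {y : EuclideanSpace ℝ (Fin 4) | ∃ u v w : EuclideanSpace ℝ (Fin 4), ‖u‖ = 1 ∧ ‖v‖ = 1 ∧ ‖w‖ = 1 ∧ u ≠ v ∧ v ≠ w ∧ u ≠ w ∧ F' (e u) = y ∧ F' (e v) = y ∧ F' (e w) = y}).ncard < ((fun y => connectedComponentIn {y : EuclideanSpace ℝ (Fin 4) | ∃ u v w : EuclideanSpace ℝ (Fin 4), ‖u‖ = 1 ∧ ‖v‖ = 1 ∧ ‖w‖ = 1 ∧ u ≠ v ∧ v ≠ w ∧ u ≠ w ∧ F (e u) = y ∧ F (e v) = y ∧ F (e w) = y} y) '' {y : EuclideanSpace ℝ (Fin 4) | ∃ u v w : EuclideanSpace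 ℝ (Fin 4), ‖u‖ = 1 ∧ ‖v‖ = 1 ∧ ‖w‖ = 1 ∧ u ≠ v ∧ v ≠ w ∧ u ≠ w ∧ F (e u) = y ∧ F (e v) = y ∧ F (e w) = y}).ncard

/-- The triple-value set of the crease of `F` (values in `ℝ⁴` with three pairwise distinct preimages
on the unit sphere of the chart). -/
def tripleValues {S : Literature.Topology.FourManifolds.HomotopySphere 4}
    (e : EuclideanSpace ℝ (Fin 4) → S.carrier) (F : S.carrier → EuclideanSpace ℝ (Fin 4)) :
    Set (EuclideanSpace ℝ (Fin 4)) :=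
  {y : EuclideanSpace ℝ (Fin 4) | ∃ u v w : EuclideanSpace ℝ (Fin 4), ‖u‖ = 1 ∧ ‖v‖ = 1 ∧ ‖w‖ = 1 ∧
    u ≠ v ∧ v ≠ w ∧ u ≠ w ∧ F (e u) = y ∧ F (e v) = y ∧ F (e w) = y}

/-- The quadruple-value set of the crease of `F`. -/
def quadValues {S : Literature.Topology.FourManifolds.HomotopySphere 4}
    (e : EuclideanSpace ℝ (Fin 4) → S.carrier) (F : S.carrier → EuclideanSpace ℝ (Fin 4)) :
    Set (EuclideanSpace ℝ (Fin 4)) :=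
  {y : EuclideanSpace ℝ (Fin 4) | ∃ a b c d : EuclideanSpace ℝ (Fin 4), ‖a‖ = 1 ∧ ‖b‖ = 1 ∧ ‖c‖ = 1 ∧
    ‖d‖ = 1 ∧ a ≠ b ∧ a ≠ c ∧ a ≠ d ∧ b ≠ c ∧ b ≠ d ∧ c ≠ d ∧ F (e a) = y ∧ F (e b) = y ∧
    F (e c) = y ∧ F (e d) = y}

/-- The set of connected components of a subset `T ⊆ ℝ⁴`. -/
def components (T : Set (EuclideanSpace ℝ (Fin 4))) : Set (Set (EuclideanSpace ℝ (Fin 4))) :=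
  (fun y => connectedComponentIn T y) '' T

/-- The immersion clause of an immersed fake ball (local diffeomorphism off `e(B̊⁴)`). -/
def IsImmersedFakeBall {S : Literature.Topology.FourManifolds.HomotopySphere 4}
    (e : EuclideanSpace ℝ (Fin 4) → S.carrier) (F : S.carrier → EuclideanSpace ℝ (Fin 4)) : Prop :=
  ∀ x, x ∉ e '' Metric.ball (0 : EuclideanSpace ℝ (Fin 4)) 1 → IsLocalDiffeomorphAt (𝓡 4) (𝓡 4) ∞ F x

/-- **stub_isolateComponent** (point-set topology, provable now): if the triple-value set `T` has
finitely many connected components, some component `c = connectedComponentIn T y` is cut out of `T`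
by an OPEN set `U` of `ℝ⁴`: `U ∩ T = c` (every component of a space with finitely many components is
relatively clopen). Size S/M. -/
theorem stub_isolateComponent :
    ∀ (S : Literature.Topology.FourManifolds.HomotopySphere 4) (e : EuclideanSpace ℝ (Fin 4) → S.carrier)
      (F : S.carrier → EuclideanSpace ℝ (Fin 4)),
      (components (tripleValues e F)).Finite → (tripleValues e F).Nonempty →
      ∃ y ∈ tripleValues e F, ∃ U : Set (EuclideanSpace ℝ (Fin 4)), IsOpen U ∧
        U ∩ tripleValues e F = connectedComponentIn (tripleValues e F) y := by
  sorry

/-- **stub_conservativeElimination** (the geometric move, the crux of the line): a quadruple-free crease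
of an immersed fake ball whose triple-value set `T` has finitely many components, one of which, `c`, is
isolated by an open set `U` (`U ∩ T = c`), can be traded — same `S`, same chart `e`, only the immersion
moves — for an immersed fake ball whose crease is still quadruple-free, has NO triple value in `U`, creates
NO NEW triple value (`T' ⊆ T`), and whose triple-value set is SATURATED for the old components (every old
component it meets it contains: other triple circles are either untouched or removed wholesale). Intended
mechanism: eliminate the triple circle `c` by a modification of `F` over `F⁻¹(U) ∩ Δ_e` (a Carter-type
elimination of one triple curve of a codimension-one immersion `S³ ↬ ℝ⁴`, performed through immersions that
stay extendable over the fake ball `Δ_e`; the whole difficulty of the rung). Size XL / open. -/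
theorem stub_conservativeElimination :
    ∀ (S : Literature.Topology.FourManifolds.HomotopySphere 4) (e : EuclideanSpace ℝ (Fin 4) → S.carrier)
      (F : S.carrier → EuclideanSpace ℝ (Fin 4)), Manifold.IsSmoothEmbedding (𝓡 4) (𝓡 4) ∞ e →
      IsImmersedFakeBall e F → quadValues e F = ∅ → (components (tripleValues e F)).Finite →
      ∀ y ∈ tripleValues e F, ∀ U : Set (EuclideanSpace ℝ (Fin 4)), IsOpen U →
        U ∩ tripleValues e F = connectedComponentIn (tripleValues e F) y →
        ∃ F' : S.carrier → EuclideanSpace ℝ (Fin 4), IsImmersedFakeBall e F' ∧ quadValues e F' = ∅ ∧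
          tripleValues e F' ⊆ tripleValues e F ∧ tripleValues e F' ∩ U = ∅ ∧
          ∀ z ∈ tripleValues e F', connectedComponentIn (tripleValues e F) z ⊆ tripleValues e F' := by
  sorry

/-- Component bookkeeping: if `T' ⊆ T` is saturated for the components of `T`, the components of `T'` are
components of `T`. -/
theorem components_subset_of_saturated {T T' : Set (EuclideanSpace ℝ (Fin 4))} (hsub : T' ⊆ T)
    (hsat : ∀ z ∈ T', connectedComponentIn T z ⊆ T') :
    components T' ⊆ components T := by
  rintro s ⟨z, hz, rfl⟩
  refine ⟨z, hsub hz, ?_⟩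
  -- `connectedComponentIn T z = connectedComponentIn T' z`
  apply Subset.antisymm
  · exact IsPreconnected.subset_connectedComponentIn isPreconnected_connectedComponentIn
      (mem_connectedComponentIn (hsub hz)) (hsat z hz)
  · exact connectedComponentIn_mono z hsub

/-- **The descent (frame form)**: the two stub statements imply the BODY of the piece — isolate a component
`c` by an open `U`, eliminate it conservatively; the new component set sits inside the old one minus `c`, so it
is finite and strictly smaller (conclusion deliberately unfolded so that only `TripleCircleElimination_of`
below concludes the piece by name — skeleton invariant A12). -/
theorem triple_step
    (h₁ : ∀ (S : Literature.Topology.FourManifolds.HomotopySphere 4) (e : EuclideanSpace ℝ (Fin 4) → S.carrier)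
      (F : S.carrier → EuclideanSpace ℝ (Fin 4)),
      (components (tripleValues e F)).Finite → (tripleValues e F).Nonempty →
      ∃ y ∈ tripleValues e F, ∃ U : Set (EuclideanSpace ℝ (Fin 4)), IsOpen U ∧
        U ∩ tripleValues e F = connectedComponentIn (tripleValues e F) y)
    (h₂ : ∀ (S : Literature.Topology.FourManifolds.HomotopySphere 4) (e : EuclideanSpace ℝ (Fin 4) → S.carrier)
      (F : S.carrier → EuclideanSpace ℝ (Fin 4)), Manifold.IsSmoothEmbedding (𝓡 4) (𝓡 4) ∞ e →
      IsImmersedFakeBall e F → quadValues e F = ∅ → (components (tripleValues e F)).Finite →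
      ∀ y ∈ tripleValues e F, ∀ U : Set (EuclideanSpace ℝ (Fin 4)), IsOpen U →
        U ∩ tripleValues e F = connectedComponentIn (tripleValues e F) y →
        ∃ F' : S.carrier → EuclideanSpace ℝ (Fin 4), IsImmersedFakeBall e F' ∧ quadValues e F' = ∅ ∧
          tripleValues e F' ⊆ tripleValues e F ∧ tripleValues e F' ∩ U = ∅ ∧
          ∀ z ∈ tripleValues e F', connectedComponentIn (tripleValues e F) z ⊆ tripleValues e F') :
    ∀ (S : Literature.Topology.FourManifolds.HomotopySphere 4) (e : EuclideanSpace ℝ (Fin 4) → S.carrier) (F : S.carrier → EuclideanSpace ℝ (Fin 4)), Manifold.IsSmoothEmbedding (𝓡 4) (𝓡 4) ∞ e → (∀ x, x ∉ e '' Metric.ball (0 : EuclideanSpace ℝ (Fin 4)) 1 → IsLocalDiffeomorphAt (𝓡 4) (𝓡 4) ∞ F x) → {y : EuclideanSpace ℝ (Fin 4) | ∃ a b c d : EuclideanSpace ℝ (Fin 4), ‖a‖ = 1 ∧ ‖b‖ = 1 ∧ ‖c‖ = 1 ∧ ‖d‖ = 1 ∧ a ≠ b ∧ a ≠ c ∧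 a ≠ d ∧ b ≠ c ∧ b ≠ d ∧ c ≠ d ∧ F (e a) = y ∧ F (e b) = y ∧ F (e c) = y ∧ F (e d) = y} = ∅ → ((fun y => connectedComponentIn {y : EuclideanSpace ℝ (Fin 4) | ∃ u v w : EuclideanSpace ℝ (Fin 4), ‖u‖ = 1 ∧ ‖v‖ = 1 ∧ ‖w‖ = 1 ∧ u ≠ v ∧ v ≠ w ∧ u ≠ w ∧ F (e u) = y ∧ F (e v) = y ∧ F (e w) = y} y) '' {y : EuclideanSpace ℝ (Fin 4) | ∃ u v w : EuclideanSpace ℝ (Fin 4), ‖u‖ = 1 ∧ ‖v‖ = 1 ∧ ‖w‖ = 1 ∧ u ≠ v ∧ v ≠ w ∧ u ≠ w ∧ F (e u) = y ∧ F (e v) = y ∧ F (e w) = y}).Finite → {y : EuclideanSpace ℝ (Fin 4) | ∃ u v w : EuclideanSpace ℝ (Fin 4), ‖u‖ = 1 ∧ ‖v‖ = 1 ∧ ‖w‖ = 1 ∧ u ≠ v ∧ v ≠ w ∧ u ≠ w ∧ F (e u) = y ∧ F (e v) = y ∧ F (e w) = y}.Nonempty → ∃ F' : S.carrier → EuclideanSpace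 ℝ (Fin 4), (∀ x, x ∉ e '' Metric.ball (0 : EuclideanSpace ℝ (Fin 4)) 1 → IsLocalDiffeomorphAt (𝓡 4) (𝓡 4) ∞ F' x) ∧ {y : EuclideanSpace ℝ (Fin 4) | ∃ a b c d : EuclideanSpace ℝ (Fin 4), ‖a‖ = 1 ∧ ‖b‖ = 1 ∧ ‖c‖ = 1 ∧ ‖d‖ = 1 ∧ a ≠ b ∧ a ≠ c ∧ a ≠ d ∧ b ≠ c ∧ b ≠ d ∧ c ≠ d ∧ F' (e a) = y ∧ F' (e b) = y ∧ F' (e c) = y ∧ F' (e d) = y} = ∅ ∧ ((fun y => connectedComponentIn {y : EuclideanSpace ℝ (Fin 4) | ∃ u v w : EuclideanSpace ℝ (Fin 4), ‖u‖ = 1 ∧ ‖v‖ = 1 ∧ ‖w‖ = 1 ∧ u ≠ v ∧ v ≠ w ∧ u ≠ w ∧ F' (e u) = y ∧ F' (e v) = y ∧ F' (e w) = y} y) '' {y : EuclideanSpace ℝ (Fin 4) | ∃ u v w : EuclideanSpace ℝ (Fin 4), ‖u‖ = 1 ∧ ‖v‖ = 1 ∧ ‖w‖ = 1 ∧ u ≠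 v ∧ v ≠ w ∧ u ≠ w ∧ F' (e u) = y ∧ F' (e v) = y ∧ F' (e w) = y}).Finite ∧ ((fun y => connectedComponentIn {y : EuclideanSpace ℝ (Fin 4) | ∃ u v w : EuclideanSpace ℝ (Fin 4), ‖u‖ = 1 ∧ ‖v‖ = 1 ∧ ‖w‖ = 1 ∧ u ≠ v ∧ v ≠ w ∧ u ≠ w ∧ F' (e u) = y ∧ F' (e v) = y ∧ F' (e w) = y} y) '' {y : EuclideanSpace ℝ (Fin 4) | ∃ u v w : EuclideanSpace ℝ (Fin 4), ‖u‖ = 1 ∧ ‖v‖ = 1 ∧ ‖w‖ = 1 ∧ u ≠ v ∧ v ≠ w ∧ u ≠ w ∧ F' (e u) = y ∧ F' (e v) = y ∧ F' (e w) = y}).ncard < ((fun y => connectedComponentIn {y : EuclideanSpace ℝ (Fin 4) | ∃ u v w : EuclideanSpace ℝ (Fin 4), ‖u‖ = 1 ∧ ‖v‖ = 1 ∧ ‖w‖ = 1 ∧ u ≠ v ∧ v ≠ w ∧ u ≠ w ∧ F (e u) = y ∧ F (e v) = y ∧ F (e w) = y} y) '' {y : EuclideanSpace ℝ (Fin 4)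 | ∃ u v w : EuclideanSpace ℝ (Fin 4), ‖u‖ = 1 ∧ ‖v‖ = 1 ∧ ‖w‖ = 1 ∧ u ≠ v ∧ v ≠ w ∧ u ≠ w ∧ F (e u) = y ∧ F (e v) = y ∧ F (e w) = y}).ncard := by
  intro S e F he hF hq hk hne
  -- all the sets of the statement are the named ones
  change IsImmersedFakeBall e F at hF
  change quadValues e F = ∅ at hq
  change (components (tripleValues e F)).Finite at hk
  change (tripleValues e F).Nonempty at hne
  show ∃ F' : S.carrier → EuclideanSpace ℝ (Fin 4), IsImmersedFakeBall e F' ∧ quadValues e F' = ∅ ∧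
    (components (tripleValues e F')).Finite ∧
    (components (tripleValues e F')).ncard < (components (tripleValues e F)).ncard
  obtain ⟨y, hy, U, hU, hUT⟩ := h₁ S e F hk hne
  obtain ⟨F', hF', hq', hsub, hdisj, hsat⟩ := h₂ S e F he hF hq hk y hy U hU hUT
  set c := connectedComponentIn (tripleValues e F) y with hc
  have hcmem : c ∈ components (tripleValues e F) := ⟨y, hy, rfl⟩
  -- the new components are old components other than `c`
  have hcomp : components (tripleValues e F') ⊆ components (tripleValues e F) \ {c} := by
    intro s hs
    refine ⟨components_subset_of_saturated hsub hsat hs, ?_⟩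
    rintro (rfl : s = c)
    obtain ⟨z, hz, hzc⟩ := hs
    -- `z ∈ c ⊆ U`, contradicting `T' ∩ U = ∅`
    have hzc' : z ∈ c := by rw [← hzc]; exact mem_connectedComponentIn hz
    have hzU : z ∈ U := by
      have : z ∈ U ∩ tripleValues e F := by rw [hUT]; exact hzc'
      exact this.1
    have : z ∈ tripleValues e F' ∩ U := ⟨hz, hzU⟩
    rw [hdisj] at this
    exact this
  refine ⟨F', hF', hq', (hk.sdiff).subset hcomp, ?_⟩
  calc (components (tripleValues e F')).ncard
      ≤ (components (tripleValues e F) \ {c}).ncard := ncard_le_ncard hcomp hk.sdiff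
    _ < (components (tripleValues e F)).ncard := ncard_sdiff_singleton_lt_of_mem hcmem hk

/-- **Composition**: the piece BY NAME from the two declared stubs (while the piece is not yet a route decl,
"by name" is the local verbatim copy `TripleCircleElimination` above; after `route edit --split CreaseCollapse`
replace it by `Summit.SmoothPoincare4.SmoothPoincare4.Theses.EuclideanOrigami.TripleCircleElimination` and
register with `ledger skeleton check … --crux <child item>`). -/
theorem TripleCircleElimination_of : TripleCircleElimination :=
  triple_step stub_isolateComponent stub_conservativeElimination

end Summit.SmoothPoincare4.SmoothPoincare4.Cruxes.CreaseCollapse.LadderTriple
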